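import Mathlib.LinearAlgebra.Basis.Basic
import Mathlib.Data.Fintype.Fin
import Literature.Computability.Complexity.ACRealizeOver
import Literature.Computability.Complexity.ConstantDepth
import Literature.Computability.MetaComplexity.NWGenerator
import HarnessLib

/-!
# NW designs computable in `AC⁰[p]`: the polynomial design over a field of characteristic `p`

Groundwork for the named fact `Literature.Computability.Learning.cikk_learn_AC0Mod` (CIKK 2016
Cor. 5.4): the learner of CIKK Thm. 5.1 for `Λ = AC⁰[p]` needs an NW design whose restriction maps
`v ↦ z|_{S_v}` are computed by small CONSTANT-DEPTH circuits with `MOD_p` gates (CIKK Thm. 3.3 /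
3.6 / 3.7), because usefulness of the natural property is invoked on the NW outputs
`g_z(v) = f*(z|_{S_v})`. The design of `NWGenerator.lean` (`cikkDesign`, polynomials over the PRIME
field `𝔽_q`, `q ≥` block size) does not have this property for `q ≠ p`; CIKK take instead an
extension field `F ⊇ 𝔽_p` with `|F| ≥` block size. This file carries out that construction and its
circuit analysis, for any prime `p`:

* `polyVal v r = Σ_{j : v j} rʲ` (the polynomial `A_v` with `0/1` coefficient string `v`,
  `eval_coeffVec`), the design `design A ℓ v = polyBlock A (coeffVec v)` over ANY field `K` with
  evaluation points `A : Fin n ↪ K` (`design_apply`, `isNWDesign_design`: pairwise intersections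
  `≤ ℓ`);
* with a basis `b` of `K` over `𝔽_p` (`t` coordinates): the coordinates of `A_v(r)` are
  `𝔽_p`-LINEAR forms in the bits of `v` (`repr_polyVal`), so the test `[A_v(r) = c]` is a
  conjunction of `t` tests `[Σⱼ aⱼ vⱼ = e (mod p)]` (`polyVal_eq_iff`);
* circuits over `accBasis p = {¬, ∧, ∨, MOD_p}` (in the calculus `ACRealOver` of
  `ACRealizeOver.lean`): one `MOD_p` gate on literals and constants realizes a linear test
  (`acRealOver_linTest`, depth `2`), whence `[A_v(r) = c]` in depth `3` (`acRealOver_polyVal_eq`)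
  and **every seed coordinate `v ↦ z(r, A_v(r))` of the design in depth `4` and size
  `O(|K| · t · ℓ · p)`** (`acRealOver_designCoord`, `acRealOver_design`) — CIKK Thm. 3.6/3.7
  (`d_MX = 4` here; CIKK: "some fixed constant depth `d_MX`").

All statements are proved; no named facts are introduced.

## References

* M. Carmosino, R. Impagliazzo, V. Kabanets, A. Kolokolova, *Learning algorithms from natural
  proofs*, CCC 2016, LIPIcs 50, §3.1, Thms. 3.3, 3.6, 3.7 [CarmosinoImpagliazzoKabanetsKolokolova2016].
* N. Nisan, A. Wigderson, *Hardness vs randomness*, JCSS 49 (1994), Lemma 2.5 (polynomial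
  designs) [NisanWigderson1994].
-/

namespace Literature.Computability.MetaComplexity

open Finset Polynomial Literature.Computability.Complexity

namespace GFDesign

variable {K : Type*} [Field K] [DecidableEq K] {n ℓ : ℕ}

/-! ### The polynomial design over an arbitrary field -/

/-- `A_v(r) = Σ_{j : v j = 1} rʲ`: the value at `r` of the polynomial with `0/1` coefficient
string `v`. [cite: CarmosinoImpagliazzoKabanetsKolokolova2016, §3.1 (proof of Thm. 3.6)] -/
def polyVal (v : Fin ℓ → Bool) (r : K) : K := ∑ j : Fin ℓ, if v j = true then r ^ (j : ℕ) else 0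

/-- `A_v` is the coefficient-vector polynomial of `coeffVec v`. [folklore] -/
theorem eval_coeffVec (v : Fin ℓ → Bool) (r : K) :
    (ofFn (ℓ + 1) (coeffVec v : Fin (ℓ + 1) → K)).eval r = polyVal v r :=
  eval_ofFn_coeffVec v r

/-- **The polynomial design over the field `K`**: block `v` is the graph `{(A i, A_v(A i))}` of
`A_v` on the evaluation points `A : Fin n ↪ K`, a block of size `n` in the universe `K × K`.
[cite: CarmosinoImpagliazzoKabanetsKolokolova2016, §3.1 (proof of Thm. 3.6)] -/
noncomputable def design (A : Fin n ↪ K) (ℓ : ℕ) : (Fin ℓ → Bool) → (Fin n ↪ K × K) :=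
  fun v => polyBlock A (coeffVec v : Fin (ℓ + 1) → K)

/-- Unfolding the design. [folklore] -/
theorem design_apply (A : Fin n ↪ K) (v : Fin ℓ → Bool) (i : Fin n) :
    design A ℓ v i = (A i, polyVal v (A i)) := by
  rw [design, polyBlock_apply, eval_coeffVec]

/-- **The design has pairwise intersections `≤ ℓ`** (two distinct polynomials of degree `≤ ℓ`
agree in at most `ℓ` points). [cite: CarmosinoImpagliazzoKabanetsKolokolova2016, §3.1 (proof of Thm. 3.6)] -/
theorem isNWDesign_design (A : Fin n ↪ K) (ℓ : ℕ) : IsNWDesign ℓ (design A ℓ) :=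
  (isNWDesign_polyBlock ℓ A).comp_injective (coeffVec_injective K ℓ)

/-! ### Coordinates over `𝔽_p`: the tests are linear -/

variable {p : ℕ} [Fact p.Prime] [Algebra (ZMod p) K] {t : ℕ}

omit [DecidableEq K] in
/-- **Coordinates of `A_v(r)` are linear forms in the bits of `v`**:
`b(A_v(r))ᵢ = Σ_{j : v j} b(rʲ)ᵢ`. [cite: CarmosinoImpagliazzoKabanetsKolokolova2016, §3.1 (proof of Thm. 3.6: "adding a subset of ℓ field elements")] -/
theorem repr_polyVal (b : Module.Basis (Fin t) (ZMod p) K) (v : Fin ℓ → Bool) (r : K) (i : Fin t) :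
    b.repr (polyVal v r) i = ∑ j : Fin ℓ, if v j = true then b.repr (r ^ (j : ℕ)) i else 0 := by
  rw [polyVal, map_sum, Finsupp.finsetSum_apply]
  refine Finset.sum_congr rfl fun j _ => ?_
  split_ifs
  · rfl
  · rw [map_zero, Finsupp.zero_apply]

omit [DecidableEq K] in
/-- The test `A_v(r) = c` coordinatewise. [folklore] -/
theorem polyVal_eq_iff (b : Module.Basis (Fin t) (ZMod p) K) (v : Fin ℓ → Bool) (r c : K) :
    polyVal v r = c ↔
      ∀ i : Fin t, (∑ j : Fin ℓ, if v j = true then b.repr (r ^ (j : ℕ)) i else 0) = b.repr c i := by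
  constructor
  · rintro rfl i
    rw [repr_polyVal]
  · intro h
    apply b.repr.injective
    ext i
    rw [repr_polyVal, h i]

/-! ### One `MOD_p` gate realizes a linear test -/

omit [Fact p.Prime] in
/-- `MOD_p` gates are in `accBasis p`. [folklore] -/
theorem modGate_mem_accBasis (p k : ℕ) : GateFn.modGate p k ∈ accBasis p :=
  Set.mem_union_right _ (Set.mem_iUnion.2 ⟨k, rfl⟩)

/-- The slots feeding the `MOD_p` gate of the linear test `Σⱼ aⱼ vⱼ = e`: for `j < ℓ`, `p - 1` slots
of which the first `aⱼ` carry the literal `vⱼ` (the others `0`); and `p - 1` constant slots of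
which the first `(p - e) mod p` carry `1`. [folklore] -/
def slotFn (a : Fin ℓ → ZMod p) (e : ZMod p) (s : Fin (ℓ + 1) × Fin (p - 1)) (v : Fin ℓ → Bool) : Bool :=
  Fin.lastCases (decide ((s.2 : ℕ) < (p - e.val) % p))
    (fun j => decide ((s.2 : ℕ) < (a j).val) && v j) s.1

omit [Fact p.Prime] in
/-- The constant slots. [folklore] -/
theorem slotFn_last (a : Fin ℓ → ZMod p) (e : ZMod p) (m : Fin (p - 1)) (v : Fin ℓ → Bool) :
    slotFn a e (Fin.last ℓ, m) v = decide ((m : ℕ) < (p - e.val) % p) := by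
  simp [slotFn]

omit [Fact p.Prime] in
/-- The literal slots. [folklore] -/
theorem slotFn_castSucc (a : Fin ℓ → ZMod p) (e : ZMod p) (j : Fin ℓ) (m : Fin (p - 1)) (v : Fin ℓ → Bool) :
    slotFn a e (j.castSucc, m) v = (decide ((m : ℕ) < (a j).val) && v j) := by
  simp [slotFn]

/-- The slots as a family indexed by the arity `(ℓ+1)(p-1)` of the gate. [folklore] -/
def slots (a : Fin ℓ → ZMod p) (e : ZMod p) (v : Fin ℓ → Bool) : Fin ((ℓ + 1) * (p - 1)) → Bool :=
  fun x => slotFn a e (finProdFinEquiv.symm x) v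

omit [Fact p.Prime] in
/-- Every slot is a literal or a constant: realized over `accBasis p` at depth `≤ 1` with `≤ 1`
gate. [folklore] -/
theorem acRealOver_slotFn (a : Fin ℓ → ZMod p) (e : ZMod p) (s : Fin (ℓ + 1) × Fin (p - 1)) :
    ACRealOver (accBasis p) (fun v : Fin ℓ → Bool => slotFn a e s v) 1 1 := by
  obtain ⟨s1, m⟩ := s
  induction s1 using Fin.lastCases with
  | last =>
    exact (acRealOver_const (acBasis_subset_accBasis p) _).congr fun v => (slotFn_last a e m v).symm
  | cast j =>
    by_cases hm : (m : ℕ) < (a j).val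
    · exact ((acRealOver_input (accBasis p) j).mono zero_le_one zero_le_one).congr fun v => by
        rw [slotFn_castSucc, decide_eq_true hm, Bool.true_and]
    · exact (acRealOver_const (acBasis_subset_accBasis p) false).congr fun v => by
        rw [slotFn_castSucc, decide_eq_false hm, Bool.false_and]

/-- **The number of ones among the slots** is `Σ_{j : v j} aⱼ + ((p - e) mod p)`. [folklore] -/
theorem numOnes_slots (a : Fin ℓ → ZMod p) (e : ZMod p) (v : Fin ℓ → Bool) :
    GateFn.numOnes (slots a e v) = (∑ j : Fin ℓ, if v j = true then (a j).val else 0) + (p - e.val) % p := by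
  have hp := (Fact.out : p.Prime)
  -- transport the count along `finProdFinEquiv`
  have h1 : GateFn.numOnes (slots a e v) =
      (univ.filter fun s : Fin (ℓ + 1) × Fin (p - 1) => slotFn a e s v = true).card := by
    unfold GateFn.numOnes slots
    rw [← Finset.card_map finProdFinEquiv.symm.toEmbedding]
    congr 1
    ext s
    simp only [Finset.mem_map_equiv, Finset.mem_filter, Finset.mem_univ, true_and,
      Equiv.symm_symm, Equiv.symm_apply_apply]
  rw [h1, Finset.card_filter, Fintype.sum_prod_type, Fin.sum_univ_castSucc]
  -- the literal slots
  have hlit : ∀ j : Fin ℓ, (∑ m : Fin (p - 1), if slotFn a e (j.castSucc, m) v = true then 1 else 0) =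
      if v j = true then (a j).val else 0 := by
    intro j
    cases hv : v j
    · simp [slotFn_castSucc, hv]
    · simp only [slotFn_castSucc, hv, Bool.and_true, decide_eq_true_eq, if_true]
      rw [← Finset.card_filter, ← Fintype.card_subtype]
      exact Fintype.card_fin_lt_of_le (Nat.le_sub_one_of_lt (ZMod.val_lt (a j)))
  -- the constant slots
  have hconst : (∑ m : Fin (p - 1), if slotFn a e (Fin.last ℓ, m) v = true then 1 else 0) =
      (p - e.val) % p := by
    simp only [slotFn_last, decide_eq_true_eq]
    rw [← Finset.card_filter, ← Fintype.card_subtype]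
    exact Fintype.card_fin_lt_of_le (Nat.le_sub_one_of_lt (Nat.mod_lt _ hp.pos))
  rw [hconst, Finset.sum_congr rfl fun j _ => hlit j]

/-- The slot count in `𝔽_p`: `Σ_{j : v j} aⱼ - e`. [folklore] -/
theorem cast_numOnes_slots (a : Fin ℓ → ZMod p) (e : ZMod p) (v : Fin ℓ → Bool) :
    ((GateFn.numOnes (slots a e v) : ℕ) : ZMod p) = (∑ j : Fin ℓ, if v j = true then a j else 0) - e := by
  rw [numOnes_slots, Nat.cast_add, ZMod.natCast_mod, Nat.cast_sub (ZMod.val_lt e).le, ZMod.natCast_self,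
    ZMod.natCast_zmod_val, zero_sub, Nat.cast_sum, ← sub_eq_add_neg]
  congr 1
  refine Finset.sum_congr rfl fun j _ => ?_
  split_ifs
  · exact ZMod.natCast_zmod_val (a j)
  · exact Nat.cast_zero

/-- **The arithmetic of the test**: the slot count is `≡ 0 (mod p)` iff the linear form hits `e`.
[folklore] -/
theorem numOnes_slots_mod_eq_zero_iff (a : Fin ℓ → ZMod p) (e : ZMod p) (v : Fin ℓ → Bool) :
    GateFn.numOnes (slots a e v) % p = 0 ↔ (∑ j : Fin ℓ, if v j = true then a j else 0) = e := by
  rw [← Nat.dvd_iff_mod_eq_zero, ← ZMod.natCast_eq_zero_iff, cast_numOnes_slots, sub_eq_zero]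

/-- **A linear test `[Σⱼ aⱼ vⱼ = e]` over `𝔽_p` is one `MOD_p` gate on literals and constants**
(negated): realized over `accBasis p` at depth `2` with `(ℓ+1)(p-1) + 2` gates.
[cite: CarmosinoImpagliazzoKabanetsKolokolova2016, §3.1 (footnote 4: sums mod p by ⊕ₚ gates)] -/
theorem acRealOver_linTest (a : Fin ℓ → ZMod p) (e : ZMod p) :
    ACRealOver (accBasis p) (fun v : Fin ℓ → Bool => decide ((∑ j : Fin ℓ, if v j = true then a j else 0) = e))
      2 ((ℓ + 1) * (p - 1) + 2) := by
  have hgate := acRealOver_gate (ι := Fin ℓ) (B := accBasis p) (GateFn.modGate p ((ℓ + 1) * (p - 1)))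
    (modGate_mem_accBasis p _) (f := fun x v => slots a e v x) (d := 1) (s := fun _ => 1)
    (fun x => acRealOver_slotFn a e (finProdFinEquiv.symm x))
  refine ((hgate.neg (acBasis_subset_accBasis p mem_acBasis_not)).mono le_rfl (le_of_eq ?_)).congr fun v => ?_
  · simp only [Finset.sum_const, Finset.card_univ, Fintype.card_fin, smul_eq_mul, mul_one]
    rfl
  -- `¬ [count % p ≠ 0] = [Σ = e]`
  change (!decide (GateFn.numOnes (fun x => slots a e v x) % p ≠ 0)) = _
  rw [show (fun x => slots a e v x) = slots a e v from rfl]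
  by_cases h : GateFn.numOnes (slots a e v) % p = 0
  · rw [(numOnes_slots_mod_eq_zero_iff a e v).1 h]; simp [h]
  · have h' : ¬(∑ j : Fin ℓ, if v j = true then a j else 0) = e :=
      fun he => h ((numOnes_slots_mod_eq_zero_iff a e v).2 he)
    simp [h, h']

/-! ### The tests `[A_v(r) = c]` and the seed coordinates `z(r, A_v(r))` -/

/-- The size of the test `[A_v(r) = c]`. [folklore] -/
def eqTestSize (t ℓ p : ℕ) : ℕ := t * ((ℓ + 1) * (p - 1) + 2) + 1

/-- **`[A_v(r) = c]` in depth `3`**: the conjunction over the `t` coordinates of the linear tests.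
[cite: CarmosinoImpagliazzoKabanetsKolokolova2016, Thm. 3.6 (proof)] -/
theorem acRealOver_polyVal_eq (b : Module.Basis (Fin t) (ZMod p) K) (r c : K) :
    ACRealOver (accBasis p) (fun v : Fin ℓ → Bool => decide (polyVal v r = c)) 3 (eqTestSize t ℓ p) := by
  have h := acRealOver_forall_const (ι := Fin ℓ) (acBasis_subset_accBasis p) (M := t) (d := 2)
    (s := (ℓ + 1) * (p - 1) + 2)
    (f := fun i v => decide ((∑ j : Fin ℓ, if v j = true then b.repr (r ^ (j : ℕ)) i else 0) = b.repr c i))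
    (fun i => acRealOver_linTest (fun j => b.repr (r ^ (j : ℕ)) i) (b.repr c i))
  refine h.congr fun v => ?_
  simp only [decide_eq_true_eq, polyVal_eq_iff b]

/-- The size of a seed coordinate. [folklore] -/
def coordSize (q t ℓ p : ℕ) : ℕ := q * (eqTestSize t ℓ p + 1) + 1

variable [Fintype K]

/-- **A seed coordinate `v ↦ z(r, A_v(r))` of the design in depth `4`** and size
`|K| · (t((ℓ+1)(p-1)+2) + 2) + 1`: the disjunction over the field elements `c` with `z(r, c) = 1`
of the tests `[A_v(r) = c]` (CIKK Thm. 3.7: `y_j = ⋁_k g(i,j,k) ∧ (z|_{U_j})_k`, the seed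
hard-wired). [cite: CarmosinoImpagliazzoKabanetsKolokolova2016, Thm. 3.7 (proof)] -/
theorem acRealOver_designCoord (b : Module.Basis (Fin t) (ZMod p) K) (z : K × K → Bool) (r : K) :
    ACRealOver (accBasis p) (fun v : Fin ℓ → Bool => z (r, polyVal v r)) 4
      (coordSize (Fintype.card K) t ℓ p) := by
  set e := Fintype.equivFin K with he
  have hmem : ∀ j : Fin (Fintype.card K), ACRealOver (accBasis p)
      (fun v : Fin ℓ → Bool => z (r, e.symm j) && decide (polyVal v r = e.symm j)) 3 (eqTestSize t ℓ p + 1) := by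
    intro j
    cases hz : z (r, e.symm j)
    · exact ((acRealOver_const (acBasis_subset_accBasis p) false).mono (by norm_num)
        (Nat.succ_le_succ (Nat.zero_le _))).congr fun v => by rw [Bool.false_and]
    · exact ((acRealOver_polyVal_eq b r (e.symm j)).mono le_rfl (Nat.le_succ _)).congr fun v => by
        rw [Bool.true_and]
  have h := acRealOver_exists_const (ι := Fin ℓ) (acBasis_subset_accBasis p) hmem
  refine h.congr fun v => ?_
  rw [Bool.eq_iff_iff, decide_eq_true_iff]
  constructor
  · rintro ⟨j, hj⟩
    rw [Bool.and_eq_true, decide_eq_true_eq] at hj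
    rw [hj.2]; exact hj.1
  · intro hz
    exact ⟨e (polyVal v r), by rw [Equiv.symm_apply_apply]; simp [hz]⟩

/-- **The restriction map of the design is in `AC⁰[p]`** (CIKK Thm. 3.3 / 3.7): for every seed
`z : K × K → {0,1}` and block position `i`, the bit `v ↦ z(S_v(i))` is realized over
`{¬, ∧, ∨, MOD_p}` at depth `4` with `coordSize |K| t ℓ p` gates.
[cite: CarmosinoImpagliazzoKabanetsKolokolova2016, Thm. 3.7] -/
theorem acRealOver_design (b : Module.Basis (Fin t) (ZMod p) K) (A : Fin n ↪ K) (z : K × K → Bool) (i : Fin n) :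
    ACRealOver (accBasis p) (fun v : Fin ℓ → Bool => z (design A ℓ v i)) 4
      (coordSize (Fintype.card K) t ℓ p) :=
  (acRealOver_designCoord b z (A i)).congr fun v => by rw [design_apply]

end GFDesign

end Literature.Computability.MetaComplexity
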